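import Summits.BirchSwinnertonDyer.BirchSwinnertonDyer.Theorems.CumulativeHeegnerLeopoldtCumulativeHeegnerInclusionAtThreeLayerControlFittingTransfer
import Summits.BirchSwinnertonDyer.BirchSwinnertonDyer.Theorems.CumulativeHeegnerLeopoldtCumulativeHeegnerInclusionAtThreeLayerTowerControl
import Summits.BirchSwinnertonDyer.Rank1Residual.X11b.AnticyclotomicModuleFinite
import HarnessLib

/-!
# Crux K1 `CumulativeHeegnerInclusionAtThree` (stmt-BirchSwinnertonDyer-24198) / crux A (stmt-26896): the
# port [P-ctl], VIII — K1's own `Σ`: LOCAL kernel annihilators at the bad places ⟹ `p^a · coker s_n = 0` ⟹ the (LT)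
# clause for `X_{∅,0}(𝔭′)` from a layer tower, with the `n`-uniform exponent `μ + a·G`

Width seat bsd-line-chl-k1-p1-w8 (`--supports stmt-BirchSwinnertonDyer-24198`). THEOREMS ONLY (no definition, no named
fact, no `sorry`); ROUTE-INDEPENDENT. Completes the Σ-PRIMITIVE (or partially imprimitive) branch of the layer-tower door:
for a finite `Σ` NOT containing all bad places, control along the tower is not exact; what the (LT) consumer needs from the
defect is only an `n`-UNIFORM annihilator (VII removed the generator count). This file reduces that annihilator to the
LOCAL kernels at the finitely many bad `v ∉ Σ`, `v ∤ p`, not split completely in `K_∞` — Greenberg's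
`ker r_{n,v} = ker (H¹(K_{n,v_n}, E[p^∞]) → H¹(K_{∞,η}, E[p^∞]))`, which in LNM 1716 §3 Lemma 3.3 has ORDER BOUNDED along the
tower (hence a uniform exponent) — kept here as a displayed HYPOTHESIS `hloc` (no named fact is minted):

* §1 `nsmul_mem_range_of_localKernel_annihilator` (generic: `K` totally complex, any `E/K`, `p`, `ℤ_p`-extension `κ` with
  topological generator, `𝔭`, `Σ`, `n`, `E(\bar K)[p^∞]^{D_𝔭 ⊓ ker κ} = 0`): if `p^a` kills `ker r_{n,v}` at every bad `v ∉ Σ`,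
  `v ∤ p` not split completely, then every `conj_{γ^{pⁿ}}`-fixed class `b` of `Sel_𝔭^Σ(K_∞, E[p^∞])` has `p^a · b = s_n(c)`
  for a Selmer class `c` over `K_n` (`c = p^a · c₀`, `c₀` the Lemma-3.2 lift; good / split / infinite places and the strict
  place need nothing: I–II).
* §2 `cell_nsmul_mem_range_of_localKernel_annihilator` — the same on the Leopoldt cell at `p = 3`, both torsion inputs
  discharged.
* §3 **`cell_fittingLayerTower_of_layerTower_of_localKernelAnnihilator`** — on the Leopoldt cell, for every `ℤ₃`-tower,
  generator, `𝔭′ ∋ 3`, FINITE `Σ`: a uniform local annihilator `3^a` (all layers, all bad `v ∉ Σ`) and a layer tower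
  `θ_m ∈ Fitt_Λ(Hom(Sel_{𝔭′}^Σ(K_m, E[3^∞]), ℚ/ℤ))·R₀⟦T⟧`, `3^μ L ∈ (θ_m) + (3^m) + (ω_m)` give
  `∃ μ′ (= μ + a·G), ∀ m, 3^{μ′} L ∈ Fitt_Λ(X_{∅,0}(𝔭′))·R₀⟦T⟧ + (3^m) + (ω_m)` — the (LT) clause of p637184 (VI + VII at each
  layer; `G` = a generator count of `X^Σ`, `XAc.module_finite`).

Crux A (26896) and K1 (24198) stay OPEN; BSD is not proved by any of this; no summit statement is proved by this seat.

References: [GreenbergLNM1716] §3 Lemmas 3.1–3.3 and p. 90; [MazurTate1987] §1; [StacksProject] Tag 07ZA;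
[Castella2018] Def. 2.2 (arXiv:1704.06608 p. 5).
-/

set_option linter.dupNamespace false
set_option autoImplicit false

noncomputable section

open scoped Classical

namespace Summit.BirchSwinnertonDyer.BirchSwinnertonDyer.Theorems.CumulativeHeegnerInclusionAtThreeLayerControlLocalAnnihilator

open NumberField IsDedekindDomain Field
open Literature.NumberTheory.EllipticCurves Literature.NumberTheory.EllipticCurves.GreenbergSelmer
open Literature.NumberTheory.EllipticCurves.IwasawaDual
open Literature.NumberTheory.GaloisRepresentations Literature.RingTheory.FittingIdeal
open Summit.BirchSwinnertonDyer.Rank1Residual.X11b Summit.BirchSwinnertonDyer.Rank1Residual.X11b.AcSelmer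
open Summit.BirchSwinnertonDyer.BirchSwinnertonDyer.Theorems.BiquadraticEisensteinDescentDefs
open Summit.BirchSwinnertonDyer.BirchSwinnertonDyer.Theorems.CumulativeHeegnerInclusionAtThreeLayerControl
open Summit.BirchSwinnertonDyer.BirchSwinnertonDyer.Theorems.CumulativeHeegnerInclusionAtThreeLayerControlCurve
open Summit.BirchSwinnertonDyer.BirchSwinnertonDyer.Theorems.CumulativeHeegnerInclusionAtThreeCellNoThreeTorsion
open Summit.BirchSwinnertonDyer.BirchSwinnertonDyer.Theorems.CumulativeHeegnerInclusionAtThreeLayerControlDual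
open Summit.BirchSwinnertonDyer.BirchSwinnertonDyer.Theorems.CumulativeHeegnerInclusionAtThreeLayerControlDualKernel
open Summit.BirchSwinnertonDyer.BirchSwinnertonDyer.Theorems.CumulativeHeegnerInclusionAtThreeLayerControlFittingTransfer
open Summit.BirchSwinnertonDyer.BirchSwinnertonDyer.Theorems.CumulativeHeegnerInclusionAtThreeLayerTowerControl

/-! ## §1 Local kernel annihilators at the bad places ⟹ `p^a · Sel[ω_n] ⊆ im s_n` -/

section Generic

variable {K : Type} [Field K] [NumberField K] {p : ℕ} [Fact p.Prime] (κ : ZpExtension K p)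
  (E : WeierstrassCurve K) [E.IsElliptic] (𝔭 : HeightOneSpectrum (𝓞 K)) (S : Set (HeightOneSpectrum (𝓞 K)))
  (n : ℕ)

/-- **`p^a` kills the local kernels at the bad places ⟹ `p^a · Sel_𝔭^Σ(K_∞, E[p^∞])[ω_n] ⊆ s_n(Sel_𝔭^Σ(K_n, E[p^∞]))`.**
Totally complex `K`, any `E/K`, `p`, `ℤ_p`-extension `κ` with topological generator `γ`, `𝔭` with
`E(\bar K)[p^∞]^{D_𝔭 ⊓ ker κ} = 0`, `Σ`, layer `n`. Hypothesis `hloc`: at every finite `v ∉ Σ`, `v ∤ p`, of BAD reduction and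
NOT split completely in `K_∞`, `p^a` kills `ker r_{n,v} = ker (H¹(κ⁻¹(pⁿℤ_p) ⊓ D_v, E[p^∞]) → H¹(ker κ ⊓ D_v, E[p^∞]))` (the
decomposition groups of `K_n` and `K_∞` at the chosen place; Greenberg's Lemma 3.3 bounds the order of this kernel
along the tower). Then for every `conj_{γ^{pⁿ}}`-fixed `b ∈ Sel_𝔭^Σ(K_∞, E[p^∞])`: `p^a · b = res_{K_n→K_∞} c` with `c ∈ Sel_𝔭^Σ(K_n, E[p^∞])`
— take `c = p^a · c₀` for the Lemma-3.2 lift `c₀` (tree `ZpExtension.mem_range_resOfLe_of_conjH1_eq`); its conjugates are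
locally trivial at the bad `v` because `res_{D_v}(conj_σ c₀) ∈ ker r_{n,v}`, and everywhere else by I §5 / II §1–§2.
[cite: GreenbergLNM1716, §3 Lemmas 3.2–3.3 and p. 90] [cite: JetchevSkinnerWan2017, §3.3 (control; shape only)] -/
theorem nsmul_mem_range_of_localKernel_annihilator [IsTotallyComplex K] {γ : absoluteGaloisGroup K}
    (hγ : κ.IsTopGenerator γ)
    (h0 : FixedPoints.addSubgroup ↥(decomp 𝔭 ⊓ κ.kerSubgroup) (E.geomPrimaryTorsion p) = ⊥) {a : ℕ}
    (hloc : ∀ v : HeightOneSpectrum (𝓞 K), (p : 𝓞 K) ∉ v.asIdeal → v ∉ S → ¬ decomp v ≤ κ.kerSubgroup →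
      ¬ E.HasGoodReductionAt v →
        ∀ y : E.subgroupH1 p (κ.layerSubgroup n ⊓ decomp v),
          E.resOfLe p (inf_le_inf_right (decomp v) (κ.kerSubgroup_le_layerSubgroup n)) y = 0 → p ^ a • y = 0)
    (b : E.subgroupH1 p κ.kerSubgroup) (hb : b ∈ selmerAc E p κ 𝔭 S)
    (hfix : E.conjH1 p κ.kerSubgroup (γ ^ p ^ n) b = b) :
    ∃ c ∈ selmerOver (κ.layerSubgroup n) (E.geomPrimaryTorsion p) p 𝔭 S,
      E.resOfLe p (κ.kerSubgroup_le_layerSubgroup n) c = p ^ a • b := by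
  have hcont := E.continuous_smul_geomPrimaryTorsion p
  have hprim : ∀ m : E.geomPrimaryTorsion p, ∃ k : ℕ, p ^ k • m = 0 := fun m ↦ by
    obtain ⟨k, hk⟩ := m.2
    exact ⟨k, Subtype.ext (by rw [AddSubgroupClass.coe_nsmul, hk, ZeroMemClass.coe_zero])⟩
  have h0' : ∀ m : E.geomPrimaryTorsion p, (∀ y ∈ decomp 𝔭 ⊓ κ.kerSubgroup, y • m = m) → m = 0 :=
    fun m hm ↦ by
      have : m ∈ FixedPoints.addSubgroup ↥(decomp 𝔭 ⊓ κ.kerSubgroup) (E.geomPrimaryTorsion p) :=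
        fun y ↦ hm y y.2
      rwa [h0, AddSubgroup.mem_bot] at this
  -- the Lemma-3.2 lift
  obtain ⟨c₀, hc₀⟩ := ZpExtension.mem_range_resOfLe_of_conjH1_eq κ hγ n hcont hprim b hfix
  refine ⟨p ^ a • c₀, ?_, by rw [map_nsmul, hc₀]⟩
  have hres : resOfLe (E.geomPrimaryTorsion p) (κ.kerSubgroup_le_layerSubgroup n) (p ^ a • c₀) ∈
      selmerOver κ.kerSubgroup (E.geomPrimaryTorsion p) p 𝔭 S := by
    rw [map_nsmul, hc₀]
    exact AddSubgroup.nsmul_mem _ hb _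
  refine (mem_selmerOver_layer_iff_away_inf κ n 𝔭 S hcont h0' hres).mpr
    ⟨fun v hv hvS σ ↦ ?_, fun w σ ↦ infConditions_descend_layer_of_isTotallyComplex κ n hres w σ⟩
  by_cases hD : decomp v ≤ κ.kerSubgroup
  · exact awayCondition_descends_layer_of_decomp_le κ n hD hv hvS hres σ
  have hv' : (p : 𝓞 K) ∉ v.asIdeal := hv
  by_cases hgood : E.HasGoodReductionAt v
  · exact awayCondition_descends_layer_of_hasGoodReductionAt E p κ hv' hgood n hvS hres σ
  -- a bad place not split completely: the local kernel annihilator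
  rw [awayKer, AddMonoidHom.mem_ker, map_nsmul, map_nsmul]
  refine hloc v hv' hvS hD hgood _ ?_
  -- `res_{ker κ ⊓ D_v} (res_{D_v} (conj_σ c₀)) = res_{ker κ ⊓ D_v} (conj_σ b) = 0`
  have e : resOfLe (E.geomPrimaryTorsion p) (inf_le_inf_right (decomp v) (κ.kerSubgroup_le_layerSubgroup n))
      (resOfLe (E.geomPrimaryTorsion p) (inf_le_left : κ.layerSubgroup n ⊓ decomp v ≤ κ.layerSubgroup n)
        (conjH1 (κ.layerSubgroup n) (E.geomPrimaryTorsion p) σ c₀)) =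
      resOfLe (E.geomPrimaryTorsion p) (inf_le_left : κ.kerSubgroup ⊓ decomp v ≤ κ.kerSubgroup)
        (resOfLe (E.geomPrimaryTorsion p) (κ.kerSubgroup_le_layerSubgroup n)
          (conjH1 (κ.layerSubgroup n) (E.geomPrimaryTorsion p) σ c₀)) := by
    have h1 := congrArg (fun φ ↦ φ (conjH1 (κ.layerSubgroup n) (E.geomPrimaryTorsion p) σ c₀))
      (resOfLe_comp_holds (M := E.geomPrimaryTorsion p)
        (inf_le_inf_right (decomp v) (κ.kerSubgroup_le_layerSubgroup n))
        (inf_le_left : κ.layerSubgroup n ⊓ decomp v ≤ κ.layerSubgroup n))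
    have h2 := congrArg (fun φ ↦ φ (conjH1 (κ.layerSubgroup n) (E.geomPrimaryTorsion p) σ c₀))
      (resOfLe_comp_holds (M := E.geomPrimaryTorsion p)
        (inf_le_left : κ.kerSubgroup ⊓ decomp v ≤ κ.kerSubgroup) (κ.kerSubgroup_le_layerSubgroup n))
    simp only [AddMonoidHom.comp_apply] at h1 h2
    rw [h1, h2]
  have e2 : resOfLe (E.geomPrimaryTorsion p) (κ.kerSubgroup_le_layerSubgroup n)
      (conjH1 (κ.layerSubgroup n) (E.geomPrimaryTorsion p) σ c₀) =
      conjH1 κ.kerSubgroup (E.geomPrimaryTorsion p) σ b := by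
    rw [← AddMonoidHom.comp_apply,
      resOfLe_comp_conjH1_holds (M := E.geomPrimaryTorsion p) (κ.kerSubgroup_le_layerSubgroup n) σ,
      AddMonoidHom.comp_apply, hc₀]
  have hbv := ((mem_selmerOver_iff _).mp (conjH1_mem_selmerOver σ hb)).1 v hv hvS 1
  rw [conjH1_one_holds, AddMonoidHom.id_apply, awayKer, AddMonoidHom.mem_ker] at hbv
  show resOfLe (E.geomPrimaryTorsion p) (inf_le_inf_right (decomp v) (κ.kerSubgroup_le_layerSubgroup n))
      (resOfLe (E.geomPrimaryTorsion p) (inf_le_left : κ.layerSubgroup n ⊓ decomp v ≤ κ.layerSubgroup n)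
        (conjH1 (κ.layerSubgroup n) (E.geomPrimaryTorsion p) σ c₀)) = 0
  rw [e, e2, hbv]

end Generic

/-! ## §2 The Leopoldt cell -/

/-- **On the Leopoldt cell**: same conclusion for EVERY `ℤ₃`-extension `κ` with topological generator `γ`, every
`𝔭′ ∋ 3`, every `Σ`, every `n` — both torsion inputs discharged (`cell_fixedPoints_decomp_inf_kerSubgroup_eq_bot`,
`IsImaginaryQuadratic.isTotallyComplex`); the only input is the local annihilator `3^a` at the bad `v ∉ Σ`, `v ∤ 3`.
[cite: GreenbergLNM1716, §3 Lemma 3.3 and p. 90] [cite: Castella2018Erratum, Thm. 1.1 (iv)] -/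
theorem cell_nsmul_mem_range_of_localKernel_annihilator :
    ∀ (W : WeierstrassCurve ℚ) [W.IsElliptic] [W.IsGloballyMinimal] (N : ℕ) [NeZero N] (K : Type) [Field K]
      [NumberField K], Summit.BirchSwinnertonDyer.Rank1Residual.Additive.ClassO6 W 3 →
      (∃ Φ : AddSubgroup (WeierstrassCurve.geomTorsion W ((3 : ℕ) : ℤ)),
        Literature.NumberTheory.EllipticCurves.Rank1Residual.IsRationalLine W 3 Φ ∧
        ∀ (v : IsDedekindDomain.HeightOneSpectrum (NumberField.RingOfIntegers ℚ)),
          ((3 : ℕ) : NumberField.RingOfIntegers ℚ) ∈ v.asIdeal → ∀ 𝔓 ∈ v.primesAbove,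
          ¬ (∀ g ∈ 𝔓.decompositionSubgroup (Field.absoluteGaloisGroup ℚ), ∀ P ∈ Φ, g • P = P) ∧
          ¬ (∀ g ∈ 𝔓.decompositionSubgroup (Field.absoluteGaloisGroup ℚ),
              ∀ P : WeierstrassCurve.geomTorsion W ((3 : ℕ) : ℤ), g • P - P ∈ Φ)) →
      W.conductorNorm ℤ = N → Literature.NumberTheory.EllipticCurves.IsImaginaryQuadratic K →
      Literature.NumberTheory.EllipticCurves.SatisfiesHeegnerHypothesis N K →
      ∀ (κ : Literature.NumberTheory.EllipticCurves.ZpExtension K 3) (γ : Field.absoluteGaloisGroup K),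
        κ.IsTopGenerator γ →
      ∀ (𝔭' : IsDedekindDomain.HeightOneSpectrum (NumberField.RingOfIntegers K)),
        ((3 : ℕ) : NumberField.RingOfIntegers K) ∈ 𝔭'.asIdeal →
      ∀ (S : Set (IsDedekindDomain.HeightOneSpectrum (NumberField.RingOfIntegers K))) (n a : ℕ),
      haveI : (W.baseChange K).IsElliptic := inferInstanceAs (W.map (algebraMap ℚ K)).IsElliptic
      (∀ v : HeightOneSpectrum (𝓞 K), ((3 : ℕ) : 𝓞 K) ∉ v.asIdeal → v ∉ S → ¬ decomp v ≤ κ.kerSubgroup →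
        ¬ (W.baseChange K).HasGoodReductionAt v →
          ∀ y : (W.baseChange K).subgroupH1 3 (κ.layerSubgroup n ⊓ decomp v),
            (W.baseChange K).resOfLe 3 (inf_le_inf_right (decomp v) (κ.kerSubgroup_le_layerSubgroup n)) y = 0 →
              3 ^ a • y = 0) →
      ∀ b ∈ selmerAc (W.baseChange K) 3 κ 𝔭' S,
        (W.baseChange K).conjH1 3 κ.kerSubgroup (γ ^ 3 ^ n) b = b →
          ∃ c ∈ selmerOver (κ.layerSubgroup n) ((W.baseChange K).geomPrimaryTorsion 3) 3 𝔭' S,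
            (W.baseChange K).resOfLe 3 (κ.kerSubgroup_le_layerSubgroup n) c = 3 ^ a • b := by
  intro W _ _ N _ K _ _ hO6 hline hN hK hHg κ γ hγ 𝔭' h𝔭' S n a hloc b hb hfix
  haveI : Fact (Nat.Prime 3) := ⟨Nat.prime_three⟩
  haveI hEK : (W.baseChange K).IsElliptic := inferInstanceAs (W.map (algebraMap ℚ K)).IsElliptic
  haveI : IsTotallyComplex K := IsImaginaryQuadratic.isTotallyComplex hK
  exact nsmul_mem_range_of_localKernel_annihilator κ (W.baseChange K) 𝔭' S n hγ
    (cell_fixedPoints_decomp_inf_kerSubgroup_eq_bot W N K hO6 hline hN hK hHg κ 𝔭' h𝔭') hloc b hb hfix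

/-! ## §3 The (LT) clause for `X_{∅,0}(𝔭′)` from a layer tower and a uniform local annihilator -/

/-- **(LT) for `X_{∅,0}(𝔭′)` from a `Σ`-layer tower + a uniform local annihilator.** On the Leopoldt cell, for every
`ℤ₃`-extension `κ` with topological generator `γ`, every `𝔭′ ∋ 3`, every FINITE `Σ` (K1's own: `Σ = ∅`): if `3^a` kills the
local kernels `ker r_{n,v}` at EVERY layer `n` and every bad `v ∉ Σ`, `v ∤ 3`, not split completely in `K_∞` (`hloc`), and at
every layer `m` there are a presentation `(f, h)` of `Hom(Sel_{𝔭′}^Σ(K_m, E[3^∞]), ℚ/ℤ)` and a layer element `θ_m` in its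
Fitting ideal (extended to `R₀⟦T⟧`) with `3^μ L ∈ (θ_m) + (3^m) + (ω_m)`, then for some `μ′` (namely `μ + a·G`, `G` a generator
count of `X^Σ`) and EVERY `m`: `3^{μ′} L ∈ Fitt_Λ(X_{∅,0}(𝔭′))·R₀⟦T⟧ + (3^m) + (ω_m)` — the (LT) clause of
`…LayerTower.temperedHeegnerInclusionAtThree_of_fittingLayerTower`. Per layer: VI (`q_m` onto, `3^a · ker q_m = 0` from
§2) and VII (Fitting transfer, `Σ`-passage). [cite: GreenbergLNM1716, §3 p. 90] [cite: MazurTate1987, §1] [cite: StacksProject, Tag 07ZA] -/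
theorem cell_fittingLayerTower_of_layerTower_of_localKernelAnnihilator :
    ∀ (W : WeierstrassCurve ℚ) [W.IsElliptic] [W.IsGloballyMinimal] (N : ℕ) [NeZero N] (K : Type) [Field K]
      [NumberField K], Summit.BirchSwinnertonDyer.Rank1Residual.Additive.ClassO6 W 3 →
      (∃ Φ : AddSubgroup (WeierstrassCurve.geomTorsion W ((3 : ℕ) : ℤ)),
        Literature.NumberTheory.EllipticCurves.Rank1Residual.IsRationalLine W 3 Φ ∧
        ∀ (v : IsDedekindDomain.HeightOneSpectrum (NumberField.RingOfIntegers ℚ)),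
          ((3 : ℕ) : NumberField.RingOfIntegers ℚ) ∈ v.asIdeal → ∀ 𝔓 ∈ v.primesAbove,
          ¬ (∀ g ∈ 𝔓.decompositionSubgroup (Field.absoluteGaloisGroup ℚ), ∀ P ∈ Φ, g • P = P) ∧
          ¬ (∀ g ∈ 𝔓.decompositionSubgroup (Field.absoluteGaloisGroup ℚ),
              ∀ P : WeierstrassCurve.geomTorsion W ((3 : ℕ) : ℤ), g • P - P ∈ Φ)) →
      W.conductorNorm ℤ = N → Literature.NumberTheory.EllipticCurves.IsImaginaryQuadratic K →
      Literature.NumberTheory.EllipticCurves.SatisfiesHeegnerHypothesis N K →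
      ∀ (κ : Literature.NumberTheory.EllipticCurves.ZpExtension K 3) (γ : Field.absoluteGaloisGroup K)
        [Fact (κ.IsTopGenerator γ)]
        (𝔭' : IsDedekindDomain.HeightOneSpectrum (NumberField.RingOfIntegers K)),
        ((3 : ℕ) : NumberField.RingOfIntegers K) ∈ 𝔭'.asIdeal →
      ∀ (S : Set (IsDedekindDomain.HeightOneSpectrum (NumberField.RingOfIntegers K))), S.Finite →
      ∀ (a : ℕ),
      haveI : (W.baseChange K).IsElliptic := inferInstanceAs (W.map (algebraMap ℚ K)).IsElliptic
      (∀ (n : ℕ) (v : HeightOneSpectrum (𝓞 K)), ((3 : ℕ) : 𝓞 K) ∉ v.asIdeal → v ∉ S → ¬ decomp v ≤ κ.kerSubgroup →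
        ¬ (W.baseChange K).HasGoodReductionAt v →
          ∀ y : (W.baseChange K).subgroupH1 3 (κ.layerSubgroup n ⊓ decomp v),
            (W.baseChange K).resOfLe 3 (inf_le_inf_right (decomp v) (κ.kerSubgroup_le_layerSubgroup n)) y = 0 →
              3 ^ a • y = 0) →
      ∀ (μ : ℕ) (L : UnrSeries 3),
      (∀ m : ℕ,
        ∃ (f : AddMonoid.End ↥(selmerOver (κ.layerSubgroup m) ((W.baseChange K).geomPrimaryTorsion 3) 3 𝔭' S))
          (_ : ∀ s, ((f s : selmerOver (κ.layerSubgroup m) ((W.baseChange K).geomPrimaryTorsion 3) 3 𝔭' S) :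
            (W.baseChange K).subgroupH1 3 (κ.layerSubgroup m)) = (W.baseChange K).conjH1 3 (κ.layerSubgroup m) γ s)
          (h : IsLocNil 3 (f - 1)) (θ : UnrSeries 3),
          θ ∈ (Module.fittingIdeal (IwasawaAlgebra 3)
            (LocNilDual (selmerOver (κ.layerSubgroup m) ((W.baseChange K).geomPrimaryTorsion 3) 3 𝔭' S) f h) 0).map
              (PowerSeries.map (Halves.toUnr 3)) ∧
          (3 : UnrSeries 3) ^ μ * L ∈ Ideal.span {θ} ⊔ Ideal.span {(3 : UnrSeries 3) ^ m} ⊔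
            Ideal.span {((1 + PowerSeries.X) ^ (3 ^ m) - 1 : UnrSeries 3)}) →
      ∃ μ' : ℕ, ∀ m : ℕ, (3 : UnrSeries 3) ^ μ' * L ∈
        (Module.fittingIdeal (IwasawaAlgebra 3) (XAc (W.baseChange K) 3 κ 𝔭' ∅ γ) 0).map
            (PowerSeries.map (Halves.toUnr 3)) ⊔
          Ideal.span {(3 : UnrSeries 3) ^ m} ⊔ Ideal.span {((1 + PowerSeries.X) ^ (3 ^ m) - 1 : UnrSeries 3)} := by
  intro W _ _ N _ K _ _ hO6 hline hN hK hHg κ γ hγ 𝔭' h𝔭' S hSfin a hloc μ L hT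
  haveI : Fact (Nat.Prime 3) := ⟨Nat.prime_three⟩
  haveI hEK : (W.baseChange K).IsElliptic := inferInstanceAs (W.map (algebraMap ℚ K)).IsElliptic
  haveI : Module.Finite (IwasawaAlgebra 3) (XAc (W.baseChange K) 3 κ 𝔭' S γ) :=
    XAc.module_finite κ 𝔭' S γ hSfin
  -- a generating family of `X^Σ` of size `G`, fixed once and for all
  obtain ⟨G, x, hx⟩ := Module.Finite.exists_fin (R := IwasawaAlgebra 3) (M := XAc (W.baseChange K) 3 κ 𝔭' S γ)
  refine ⟨a * G + μ, fun m ↦ ?_⟩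
  obtain ⟨f, hf, h, θ, hθ, hrec⟩ := hT m
  -- the canonical `u = s_m`
  let u : ↥(selmerOver (κ.layerSubgroup m) ((W.baseChange K).geomPrimaryTorsion 3) 3 𝔭' S) →+
      ↥(selmerAc (W.baseChange K) 3 κ 𝔭' S) :=
    { toFun := fun c ↦ ⟨(W.baseChange K).resOfLe 3 (κ.kerSubgroup_le_layerSubgroup m) c,
        resOfLe_layer_mem_selmerOver κ m c.2⟩
      map_zero' := Subtype.ext (by simp)
      map_add' := fun c c' ↦ Subtype.ext (by simp) }
  have hu : ∀ c, ((u c : selmerAc (W.baseChange K) 3 κ 𝔭' S) : (W.baseChange K).subgroupH1 3 κ.kerSubgroup) =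
      (W.baseChange K).resOfLe 3 (κ.kerSubgroup_le_layerSubgroup m) c := fun _ ↦ rfl
  obtain ⟨q, hqsurj, hq⟩ :=
    cell_exists_dualLayerMap_surjective W N K hO6 hline hN hK hHg κ γ 𝔭' S m f hf h u hu
  have hcoker := cell_nsmul_mem_range_of_localKernel_annihilator W N K hO6 hline hN hK hHg κ γ hγ.out 𝔭' h𝔭' S m a
    (hloc m)
  have hann : ∀ z, q z = 0 → 3 ^ a • z = 0 := fun z hz ↦
    smul_eq_zero_of_ker_dualLayerMap κ (W.baseChange K) 𝔭' S γ m u hu q hq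
      (fun b hb hfix ↦ hcoker b hb hfix) hz
  have hω : PowerSeries.map (Halves.toUnr 3) ((1 + PowerSeries.X : IwasawaAlgebra 3) ^ (3 ^ m) - 1) ∈
      Ideal.span {(3 : UnrSeries 3) ^ m} ⊔ Ideal.span {((1 + PowerSeries.X) ^ (3 ^ m) - 1 : UnrSeries 3)} := by
    rw [map_toUnr_omega]
    exact Ideal.mem_sup_right (Ideal.mem_span_singleton_self _)
  have key := (mem_map_fittingIdeal_sup_of_annihilator κ (W.baseChange K) 𝔭' S γ m q hqsurj hann x
    (by exact_mod_cast hx) (PowerSeries.map (Halves.toUnr 3)) _ hω hθ (by simpa only [sup_assoc] using hrec)).2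
  rw [map_pow, map_natCast, Nat.cast_ofNat, ← mul_assoc, ← pow_add] at key
  simpa only [sup_assoc] using key

end Summit.BirchSwinnertonDyer.BirchSwinnertonDyer.Theorems.CumulativeHeegnerInclusionAtThreeLayerControlLocalAnnihilator

end
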